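import Summits.SmoothPoincare4.SmoothPoincare4.Theorems.SullivanDualHyperbolicEndTaubesModelDefs

/-!
# Route `SullivanDual`, crux `HyperbolicEnd` (stmt-SmoothPoincare4-7825), line `taubes-circle-pencil`:
# exactness `ωT = dλ_T` of Taubes' untwisted model form

Registered helper `helper_taubesForm_exact` of the checked skeleton: at every point `y` of a flat
Taubes tube `taubesTube δ`, `0 < δ < 1`, and for constant vector fields `u, v` on `ℝ⁴`,
`(dλ_T)(u, v) = ∂_u λ_T(v) − ∂_v λ_T(u) = ωT(u, v)`, written with `fderiv` of the explicit formulas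
of `Theorems/SullivanDualHyperbolicEndTaubesModelDefs.lean`, for Taubes' primitive
`λ_T = −Q dt − H dφ` in flat coordinates:
`λ_T(x)(w) = −Q(x) dt_x(w) − x₃ ((r − 1) w₂ − x₂ da_x(w))`, `Q(x) = ((r − 1)² + x₂² − 2x₃²)/2`
(Taubes, Geom. Topol. 2 (1998), §1, eq. (1.10): `ω = dt ∧ df + dφ ∧ dh` with `f = Q`; the second
summand `H dφ = c (a db − b da)` is polynomial in the toroidal frame, no `dφ`-singularity).

Method.  On the tube `r = taubesR y > 0` (`δ < 1`), so every building block — the coordinates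
`xᵢ`, `r = √(x₀² + x₁²)`, `dt(v) = (x₀v₁ − x₁v₀)/r²`, `da(v) = (x₀v₀ + x₁v₁)/r` — is Fréchet
differentiable at `y` (chain rule with `√` and `⁻¹` away from `0`), with `∂_u r = da(u)` and hence
`∂_u Q = dQ(u)`.  The product rule expresses `∂_u λ_T(v)` through the block values and the block
derivatives `∂_u dt(v)`, `∂_u da(v)`; in the antisymmetrisation `∂_u λ_T(v) − ∂_v λ_T(u)` these
block derivatives only enter through `∂_u dt(v) − ∂_v dt(u) = 0` (`dt = d arg(x₀ + ix₁)` is closed)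
and `∂_u da(v) − ∂_v da(u) = 0` (`da = dr` is exact), and what remains is `taubesForm y u v` on the
nose (`linear_combination`).
-/

-- the registered namespace `Summit.SmoothPoincare4.SmoothPoincare4.…` repeats a component (P = Sub)
set_option linter.dupNamespace false

noncomputable section

namespace Summit.SmoothPoincare4.SmoothPoincare4.Cruxes.HyperbolicEnd.TaubesCirclePencil

/-! ### Derivatives of the building blocks off the axis -/

/-- On a tube of radius `< 1` the distance from the axis is positive (private copy of the sibling
identities file's lemma). [folklore] -/
private theorem exact_taubesR_pos (δ : ℝ) (y : EuclideanSpace ℝ (Fin 4)) (hδ0 : 0 < δ)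
    (hδ : δ < 1) (hy : y ∈ taubesTube δ) : 0 < taubesR y := by
  rw [mem_taubesTube] at hy
  by_contra h
  have h0 : taubesR y = 0 := le_antisymm (not_lt.mp h) (Real.sqrt_nonneg _)
  have h1 : (1 : ℝ) ≤ (taubesR y - 1) ^ 2 + y 2 ^ 2 + y 3 ^ 2 := by
    rw [h0]; nlinarith [sq_nonneg (y 2), sq_nonneg (y 3)]
  nlinarith [hδ0, hδ, h1, hy]

/-- The coordinate functions `x ↦ xᵢ` are differentiable with derivative the projection. [folklore] -/
private theorem exact_hasFDerivAt_coord (i : Fin 4) (y : EuclideanSpace ℝ (Fin 4)) :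
    HasFDerivAt (fun x : EuclideanSpace ℝ (Fin 4) => x i)
      (PiLp.proj (𝕜 := ℝ) 2 (fun _ : Fin 4 => ℝ) i) y :=
  PiLp.hasFDerivAt_apply 2 y i

/-- Off the axis, `r = √(x₀² + x₁²)` is differentiable with `∂_u r = da(u)`. [folklore] -/
private theorem exact_fderiv_taubesR (y : EuclideanSpace ℝ (Fin 4)) (hr : 0 < taubesR y) :
    DifferentiableAt ℝ taubesR y ∧ ∀ u, fderiv ℝ taubesR y u = taubesDa y u := by
  have hr0 : Real.sqrt (y 0 ^ 2 + y 1 ^ 2) ≠ 0 := hr.ne'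
  have hN : y 0 ^ 2 + y 1 ^ 2 ≠ 0 := by
    intro h
    apply hr0
    rw [h, Real.sqrt_zero]
  have h : HasFDerivAt taubesR _ y :=
    (((exact_hasFDerivAt_coord 0 y).pow 2).fun_add ((exact_hasFDerivAt_coord 1 y).pow 2)).sqrt hN
  refine ⟨h.differentiableAt, fun u => ?_⟩
  rw [h.fderiv]
  simp only [smul_apply, add_apply, PiLp.proj_apply, smul_eq_mul, nsmul_eq_mul, Nat.cast_ofNat,
    Nat.add_one_sub_one, pow_one]
  rw [taubesDa, taubesR]
  field_simp

/-- Off the axis, `x ↦ da_x(v)` is differentiable, with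
`∂_u da(v) = (u₀v₀ + u₁v₁)/r − (y₀v₀ + y₁v₁) da(u)/r²`. [folklore] -/
private theorem exact_fderiv_taubesDa (y : EuclideanSpace ℝ (Fin 4)) (hr : 0 < taubesR y)
    (v : EuclideanSpace ℝ (Fin 4)) :
    DifferentiableAt ℝ (fun x => taubesDa x v) y ∧
    ∀ u, fderiv ℝ (fun x => taubesDa x v) y u =
      (u 0 * v 0 + u 1 * v 1) / taubesR y
        - (y 0 * v 0 + y 1 * v 1) * taubesDa y u / taubesR y ^ 2 := by
  obtain ⟨hRd, hRf⟩ := exact_fderiv_taubesR y hr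
  have hr0 : taubesR y ≠ 0 := hr.ne'
  have hfun : (fun x => taubesDa x v) =
      fun x : EuclideanSpace ℝ (Fin 4) => (x 0 * v 0 + x 1 * v 1) * (taubesR x)⁻¹ := by
    funext x
    rw [taubesDa, div_eq_mul_inv]
  have hinv : HasFDerivAt (fun x : EuclideanSpace ℝ (Fin 4) => (taubesR x)⁻¹) _ y :=
    (hasDerivAt_inv hr0).comp_hasFDerivAt y hRd.hasFDerivAt
  have h : HasFDerivAt
      (fun x : EuclideanSpace ℝ (Fin 4) => (x 0 * v 0 + x 1 * v 1) * (taubesR x)⁻¹) _ y :=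
    (((exact_hasFDerivAt_coord 0 y).mul_const (v 0)).fun_add
      ((exact_hasFDerivAt_coord 1 y).mul_const (v 1))).fun_mul hinv
  rw [hfun]
  refine ⟨h.differentiableAt, fun u => ?_⟩
  rw [h.fderiv]
  simp only [smul_apply, add_apply, PiLp.proj_apply, smul_eq_mul]
  rw [hRf u, taubesDa]
  field_simp
  ring

/-- Off the axis, `x ↦ dt_x(v) = (x₀v₁ − x₁v₀)/(x₀² + x₁²)` is differentiable, with an explicit
(rational) derivative. [folklore] -/
private theorem exact_fderiv_taubesDt (y : EuclideanSpace ℝ (Fin 4)) (hr : 0 < taubesR y)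
    (v : EuclideanSpace ℝ (Fin 4)) :
    DifferentiableAt ℝ (fun x => taubesDt x v) y ∧
    ∀ u, fderiv ℝ (fun x => taubesDt x v) y u =
      (u 0 * v 1 - u 1 * v 0) / (y 0 ^ 2 + y 1 ^ 2)
        - (y 0 * v 1 - y 1 * v 0) * (2 * (y 0 * u 0 + y 1 * u 1)) / (y 0 ^ 2 + y 1 ^ 2) ^ 2 := by
  have hr0 : Real.sqrt (y 0 ^ 2 + y 1 ^ 2) ≠ 0 := hr.ne'
  have hN : y 0 ^ 2 + y 1 ^ 2 ≠ 0 := by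
    intro h
    apply hr0
    rw [h, Real.sqrt_zero]
  have hfun : (fun x => taubesDt x v) =
      fun x : EuclideanSpace ℝ (Fin 4) => (x 0 * v 1 - x 1 * v 0) * (x 0 ^ 2 + x 1 ^ 2)⁻¹ := by
    funext x
    rw [taubesDt, taubesR, Real.sq_sqrt (add_nonneg (sq_nonneg (x 0)) (sq_nonneg (x 1))),
      div_eq_mul_inv]
  have hNd : HasFDerivAt (fun x : EuclideanSpace ℝ (Fin 4) => x 0 ^ 2 + x 1 ^ 2) _ y :=
    ((exact_hasFDerivAt_coord 0 y).pow 2).fun_add ((exact_hasFDerivAt_coord 1 y).pow 2)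
  have hinv : HasFDerivAt (fun x : EuclideanSpace ℝ (Fin 4) => (x 0 ^ 2 + x 1 ^ 2)⁻¹) _ y :=
    (hasDerivAt_inv hN).comp_hasFDerivAt y hNd
  have h : HasFDerivAt (fun x : EuclideanSpace ℝ (Fin 4) =>
      (x 0 * v 1 - x 1 * v 0) * (x 0 ^ 2 + x 1 ^ 2)⁻¹) _ y :=
    (((exact_hasFDerivAt_coord 0 y).mul_const (v 1)).fun_sub
      ((exact_hasFDerivAt_coord 1 y).mul_const (v 0))).fun_mul hinv
  rw [hfun]
  refine ⟨h.differentiableAt, fun u => ?_⟩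
  rw [h.fderiv]
  simp only [smul_apply, add_apply, sub_apply, PiLp.proj_apply, smul_eq_mul, nsmul_eq_mul,
    Nat.cast_ofNat, Nat.add_one_sub_one, pow_one]
  field_simp
  ring

/-! ### The two symmetries: `dt` and `da` are closed -/

/-- `∂_a dt(b) = ∂_b dt(a)` off the axis (`dt = d arg` is closed). [folklore] -/
private theorem exact_taubesDt_symm (y : EuclideanSpace ℝ (Fin 4)) (hr : 0 < taubesR y)
    (a b : EuclideanSpace ℝ (Fin 4)) :
    fderiv ℝ (fun x => taubesDt x b) y a = fderiv ℝ (fun x => taubesDt x a) y b := by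
  have hr0 : Real.sqrt (y 0 ^ 2 + y 1 ^ 2) ≠ 0 := hr.ne'
  have hN : y 0 ^ 2 + y 1 ^ 2 ≠ 0 := by
    intro h
    apply hr0
    rw [h, Real.sqrt_zero]
  rw [(exact_fderiv_taubesDt y hr b).2 a, (exact_fderiv_taubesDt y hr a).2 b]
  field_simp
  ring

/-- `∂_a da(b) = ∂_b da(a)` off the axis (`da = dr` is exact). [folklore] -/
private theorem exact_taubesDa_symm (y : EuclideanSpace ℝ (Fin 4)) (hr : 0 < taubesR y)
    (a b : EuclideanSpace ℝ (Fin 4)) :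
    fderiv ℝ (fun x => taubesDa x b) y a = fderiv ℝ (fun x => taubesDa x a) y b := by
  have hr0 : taubesR y ≠ 0 := hr.ne'
  rw [(exact_fderiv_taubesDa y hr b).2 a, (exact_fderiv_taubesDa y hr a).2 b, taubesDa, taubesDa]
  field_simp

/-! ### The derivative of Taubes' primitive `λ_T` through the block derivatives -/

/-- Product rule: `∂_u λ_T(v)` for Taubes' primitive
`λ_T(x)(v) = −Q(x) dt_x(v) − x₃ ((r − 1) v₂ − x₂ da_x(v))`, `Q = ((r − 1)² + x₂² − 2x₃²)/2`, in terms
of the block values and block derivatives at `y` (with `∂_u r = da(u)`, so `∂_u Q = dQ(u)`).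
[folklore] -/
private theorem exact_fderiv_taubesPrim (y : EuclideanSpace ℝ (Fin 4)) (hr : 0 < taubesR y)
    (v : EuclideanSpace ℝ (Fin 4)) :
    DifferentiableAt ℝ (fun x => -(((taubesR x - 1) ^ 2 + x 2 ^ 2 - 2 * x 3 ^ 2) / 2) * taubesDt x v
      - x 3 * ((taubesR x - 1) * v 2 - x 2 * taubesDa x v)) y ∧
    ∀ u, fderiv ℝ (fun x => -(((taubesR x - 1) ^ 2 + x 2 ^ 2 - 2 * x 3 ^ 2) / 2) * taubesDt x v
      - x 3 * ((taubesR x - 1) * v 2 - x 2 * taubesDa x v)) y u =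
      -taubesDQ y u * taubesDt y v
        - ((taubesR y - 1) ^ 2 + y 2 ^ 2 - 2 * y 3 ^ 2) / 2 * fderiv ℝ (fun x => taubesDt x v) y u
        - u 3 * ((taubesR y - 1) * v 2 - y 2 * taubesDa y v)
        - y 3 * (taubesDa y u * v 2 - u 2 * taubesDa y v
          - y 2 * fderiv ℝ (fun x => taubesDa x v) y u) := by
  obtain ⟨hRd, hRf⟩ := exact_fderiv_taubesR y hr
  obtain ⟨hTd, -⟩ := exact_fderiv_taubesDt y hr v
  obtain ⟨hAd, -⟩ := exact_fderiv_taubesDa y hr v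
  have hfun : (fun x => -(((taubesR x - 1) ^ 2 + x 2 ^ 2 - 2 * x 3 ^ 2) / 2) * taubesDt x v
      - x 3 * ((taubesR x - 1) * v 2 - x 2 * taubesDa x v)) =
      fun x : EuclideanSpace ℝ (Fin 4) =>
        -(((taubesR x - 1) ^ 2 + x 2 ^ 2 - 2 * x 3 ^ 2) * 2⁻¹) * taubesDt x v
          - x 3 * ((taubesR x - 1) * v 2 - x 2 * taubesDa x v) := by
    funext x
    rw [div_eq_mul_inv]
  have hQ : HasFDerivAt
      (fun x : EuclideanSpace ℝ (Fin 4) => (taubesR x - 1) ^ 2 + x 2 ^ 2 - 2 * x 3 ^ 2) _ y :=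
    (((hRd.hasFDerivAt.sub_const 1).pow 2).fun_add ((exact_hasFDerivAt_coord 2 y).pow 2)).fun_sub
      (((exact_hasFDerivAt_coord 3 y).pow 2).const_mul 2)
  have h : HasFDerivAt (fun x : EuclideanSpace ℝ (Fin 4) =>
      -(((taubesR x - 1) ^ 2 + x 2 ^ 2 - 2 * x 3 ^ 2) * 2⁻¹) * taubesDt x v
        - x 3 * ((taubesR x - 1) * v 2 - x 2 * taubesDa x v)) _ y :=
    ((hQ.mul_const 2⁻¹).fun_neg.fun_mul hTd.hasFDerivAt).fun_sub
      ((exact_hasFDerivAt_coord 3 y).fun_mul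
        (((hRd.hasFDerivAt.sub_const 1).mul_const (v 2)).fun_sub
          ((exact_hasFDerivAt_coord 2 y).fun_mul hAd.hasFDerivAt)))
  rw [hfun]
  refine ⟨h.differentiableAt, fun u => ?_⟩
  rw [h.fderiv]
  simp only [smul_apply, add_apply, sub_apply, neg_apply, PiLp.proj_apply, smul_eq_mul,
    nsmul_eq_mul, Nat.cast_ofNat, Nat.add_one_sub_one, pow_one]
  rw [hRf u, taubesDQ]
  ring

/-! ### Exactness -/

/-- **`ωT = dλ_T` on the Taubes tube** (Taubes 1998, §1, eq. (1.10): `ωT = dt ∧ dQ + ⋆₃dQ` has the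
primitive `λ_T = −Q dt − H dφ`, `H dφ = c (a db − b da)`): for `0 < δ < 1`, `y ∈ taubesTube δ` and
constant vector fields `u, v`, with `λ_T(x)(w) = −Q(x) dt_x(w) − x₃ ((r − 1) w₂ − x₂ da_x(w))`,
`Q(x) = ((r − 1)² + x₂² − 2x₃²)/2`, one has `∂_u λ_T(v) − ∂_v λ_T(u) = ωT(u, v)`. [folklore] -/
theorem helper_taubesForm_exact : ∀ (δ : ℝ) (y : EuclideanSpace ℝ (Fin 4)), 0 < δ → δ < 1 → y ∈ taubesTube δ → ∀ u v : EuclideanSpace ℝ (Fin 4), fderiv ℝ (fun x => -(((taubesR x - 1) ^ 2 + x 2 ^ 2 - 2 * x 3 ^ 2) / 2) * taubesDt x v - x 3 * ((taubesR x - 1) * v 2 - x 2 * taubesDa x v)) y u - fderiv ℝ (fun x => -(((taubesR x - 1) ^ 2 + x 2 ^ 2 - 2 * x 3 ^ 2) / 2) * taubesDt x u - x 3 * ((taubesR x - 1) * u 2 - x 2 * taubesDa x u)) y v = taubesForm y u v := by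
  intro δ y hδ0 hδ hy u v
  have hr : 0 < taubesR y := exact_taubesR_pos δ y hδ0 hδ hy
  rw [(exact_fderiv_taubesPrim y hr v).2 u, (exact_fderiv_taubesPrim y hr u).2 v, taubesForm]
  have hT := exact_taubesDt_symm y hr u v
  have hD := exact_taubesDa_symm y hr u v
  linear_combination (-(((taubesR y - 1) ^ 2 + y 2 ^ 2 - 2 * y 3 ^ 2) / 2)) * hT
    + (y 3 * y 2) * hD

end Summit.SmoothPoincare4.SmoothPoincare4.Cruxes.HyperbolicEnd.TaubesCirclePencil

end
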